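import Summits.BirchSwinnertonDyer.BirchSwinnertonDyer.Theses.BiquadraticEisensteinDescent
import Summits.BirchSwinnertonDyer.BirchSwinnertonDyer.Theorems.BiquadraticEisensteinDescentHeegnerTwistCouplingInSupplySplitPrimeOrderFamilies
import HarnessLib

set_option linter.dupNamespace false -- `Summit.BirchSwinnertonDyer.BirchSwinnertonDyer.Theorems.…` (summit = sub, D-0017)
set_option autoImplicit false

/-!
# Crux `HeegnerTwistCouplingInSupply` (stmt-BirchSwinnertonDyer-21381), card `genus-doubling-free-box` —
# DOOR: the crux BY NAME from certified non-vanishing (the card's transfer `C ⟸ NVΩ`)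

Route `BiquadraticEisensteinDescent` (cell `pub/bsd-wall`; width seat `bsd-wall-cm-bed-w4` g25; theorems only,
`--supports 21381`). Sequel of `…SplitPrimeOrderFamilies.lean` (the certificates).

The card's transfer statement, typed against the route decl: the crux `HeegnerTwistCouplingInSupply` follows from
**NVΩ (certified non-vanishing)** — «for every corner `(W, p)` there is a Heegner field `K′` for `N_W` with `|d_{K′}| > 4`,
`L(W^{d_{K′}}, 1) ≠ 0`, and `d_{K′}` inside a CERTIFIED `p`-free box: some known divisor `m ∣ h(K′)` with `p ∤ m` and
`√|d|·log|d| < π·p·lcm(m, 2^{ω(|d|)−1})`» — the genus box (G) is `m = 1`, the Mersenne box (M) is `m = n − 2` for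
`d = x² − 2ⁿ` (`…SplitPrimeOrderFamilies.sub_two_dvd_classNumber_of_discr_eq_sq_sub_two_pow`). The class group has left
the problem: the crux's own `∀ B`-supply hypothesis is not used, and `p ∤ h(K′)` is discharged by
`not_dvd_classNumber_of_dvd_of_sqrt_mul_log_lt`.

* `heegnerTwistCouplingInSupply_of_certifiedNonvanishing` — ★ DOOR: NVΩ ⟹ the route decl BY NAME (conditional on NVΩ,
  which is research: an `L`-side engine producing non-vanishing Heegner twists of composite / Mersenne shape).
* `cruxConclusion_of_genus_witness`, `cruxConclusion_of_mersenne_witness` — pointwise forms at one `(W, p)`: ONE Heegner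
  field in the genus box, resp. ONE Mersenne-shaped Heegner discriminant, with `L(W^d, 1) ≠ 0` gives the crux's conclusion.

HONEST FRAMING: glue only; NVΩ is open, and nothing here proves `L(W^d, 1) ≠ 0` for any `d`, C⁺, the crux, or BSD;
stmt-21381 is NOT closed. No definition, no named fact, no `sorry`; axioms standard.
[cite: Oesterle1988Gauss, II §3 Proposition p. 57 (27)] [cite: Cox2013, §3.B Thm. 3.15, §7.B Thm. 7.7]
-/

noncomputable section

open scoped Classical
open Literature.NumberTheory.EllipticCurves
open Summit.BirchSwinnertonDyer.BirchSwinnertonDyer.Theorems.SplitPrimeOrder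

namespace Summit.BirchSwinnertonDyer.BirchSwinnertonDyer.Theorems.SplitPrimeOrderDoor

/-- ★ **DOOR: the crux `HeegnerTwistCouplingInSupply` BY NAME from certified non-vanishing (NVΩ).** If for every
`(W, p)` of the CM inert-bad corner (`W` CM of analytic rank one, `p ≥ 5` CM-inert and bad) there is an imaginary
quadratic Heegner field `K′` for `N_W` with `|d_{K′}| > 4`, `L(W^{d_{K′}}, 1) ≠ 0` and a certificate
`m ∣ h(K′)`, `p ∤ m`, `√|d_{K′}|·log|d_{K′}| < π·p·lcm(m, 2^{ω(|d_{K′}|)−1})`, then the crux holds (the certificate gives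
`p ∤ h(K′)`; the crux's supply hypothesis is dropped). [folklore] -/
theorem heegnerTwistCouplingInSupply_of_certifiedNonvanishing
    (hNV : ∀ (W : WeierstrassCurve ℚ) [W.IsElliptic] [W.IsGloballyMinimal] (p : ℕ) [Fact p.Prime]
      [NeZero (W.conductorNorm ℤ)], W.HasCM → W.analyticRank = 1 → 5 ≤ p →
      Literature.NumberTheory.EllipticCurves.Rank1Residual.CMInert W p →
      ¬ Literature.NumberTheory.EllipticCurves.Rank1Residual.Good W p →
      ∃ (K : Type) (_ : Field K) (_ : NumberField K), IsImaginaryQuadratic K ∧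
        4 < (NumberField.discr K).natAbs ∧ SatisfiesHeegnerHypothesis (W.conductorNorm ℤ) K ∧
        (W.quadraticTwist (NumberField.discr K : ℚ)).entireLFunction 1 ≠ 0 ∧
        ∃ m : ℕ, m ∣ NumberField.classNumber K ∧ ¬ p ∣ m ∧
          Real.sqrt ((NumberField.discr K).natAbs : ℝ) * Real.log ((NumberField.discr K).natAbs : ℝ) <
            Real.pi * (p * Nat.lcm m (2 ^ ((NumberField.discr K).natAbs.primeFactors.card - 1)) : ℕ)) :
    Summit.BirchSwinnertonDyer.BirchSwinnertonDyer.Theses.BiquadraticEisensteinDescent.HeegnerTwistCouplingInSupply := by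
  intro W _ _ p _ _ hCM hr hp5 hin hbad _
  obtain ⟨K, iF, iN, hK, h4, hH, hL, m, hm, hpm, hlt⟩ := hNV W p hCM hr hp5 hin hbad
  have hp : p.Prime := Fact.out
  have hp2 : p ≠ 2 := by omega
  exact ⟨K, iF, iN, hK, h4, hH, hL, not_dvd_classNumber_of_dvd_of_sqrt_mul_log_lt hK h4 hm hp hp2 hpm hlt⟩

/-- **Pointwise, genus box (lever (G)).** At one `(W, p)` with `p` an odd prime: ONE imaginary quadratic Heegner field
`K′` for `N_W` with `|d_{K′}| > 4`, `L(W^{d_{K′}}, 1) ≠ 0` and `√|d_{K′}|·log|d_{K′}| < π·p·2^{ω(|d_{K′}|)−1}` gives the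
conclusion of `HeegnerTwistCouplingInSupply` at `(W, p)`. [folklore] -/
theorem cruxConclusion_of_genus_witness (W : WeierstrassCurve ℚ) [W.IsElliptic] {p : ℕ} (hp : p.Prime)
    (hp2 : p ≠ 2) (K : Type) [Field K] [NumberField K] (hK : IsImaginaryQuadratic K)
    (h4 : 4 < (NumberField.discr K).natAbs) (hH : SatisfiesHeegnerHypothesis (W.conductorNorm ℤ) K)
    (hL : (W.quadraticTwist (NumberField.discr K : ℚ)).entireLFunction 1 ≠ 0)
    (hlt : Real.sqrt ((NumberField.discr K).natAbs : ℝ) * Real.log ((NumberField.discr K).natAbs : ℝ) <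
      Real.pi * (p * 2 ^ ((NumberField.discr K).natAbs.primeFactors.card - 1) : ℕ)) :
    ∃ (K : Type) (_ : Field K) (_ : NumberField K), IsImaginaryQuadratic K ∧
      4 < (NumberField.discr K).natAbs ∧ SatisfiesHeegnerHypothesis (W.conductorNorm ℤ) K ∧
      (W.quadraticTwist (NumberField.discr K : ℚ)).entireLFunction 1 ≠ 0 ∧ ¬ p ∣ NumberField.classNumber K :=
  ⟨K, inferInstance, inferInstance, hK, h4, hH, hL, not_dvd_classNumber_of_sqrt_mul_log_lt_genus hK h4 hp hp2 hlt⟩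

/-- **Pointwise, Mersenne box (lever (M)).** At one `(W, p)` with `p` an odd prime: ONE imaginary quadratic Heegner field
`K′` for `N_W` with `d_{K′} = x² − 2ⁿ` (`x` odd, `n ≥ 3`, `x² < 2^{n−1}`), `p ∤ n − 2`, `L(W^{d_{K′}}, 1) ≠ 0` and
`√|d_{K′}|·log|d_{K′}| < π·p·lcm(n − 2, 2^{ω(|d_{K′}|)−1})` gives the conclusion of `HeegnerTwistCouplingInSupply` at
`(W, p)` (`p ∤ h(K′)` by `not_dvd_classNumber_mersenne`). [folklore] -/
theorem cruxConclusion_of_mersenne_witness (W : WeierstrassCurve ℚ) [W.IsElliptic] {p : ℕ} (hp : p.Prime)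
    (hp2 : p ≠ 2) (K : Type) [Field K] [NumberField K] (hK : IsImaginaryQuadratic K)
    {x : ℤ} {n : ℕ} (hn : 3 ≤ n) (hd : NumberField.discr K = x ^ 2 - 2 ^ n) (hx : Odd x)
    (hsmall : x ^ 2 < 2 ^ (n - 1)) (hpn : ¬ p ∣ n - 2)
    (hH : SatisfiesHeegnerHypothesis (W.conductorNorm ℤ) K)
    (hL : (W.quadraticTwist (NumberField.discr K : ℚ)).entireLFunction 1 ≠ 0)
    (hlt : Real.sqrt ((NumberField.discr K).natAbs : ℝ) * Real.log ((NumberField.discr K).natAbs : ℝ) <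
      Real.pi * (p * Nat.lcm (n - 2) (2 ^ ((NumberField.discr K).natAbs.primeFactors.card - 1)) : ℕ)) :
    ∃ (K : Type) (_ : Field K) (_ : NumberField K), IsImaginaryQuadratic K ∧
      4 < (NumberField.discr K).natAbs ∧ SatisfiesHeegnerHypothesis (W.conductorNorm ℤ) K ∧
      (W.quadraticTwist (NumberField.discr K : ℚ)).entireLFunction 1 ≠ 0 ∧ ¬ p ∣ NumberField.classNumber K := by
  have h4 : 4 < (NumberField.discr K).natAbs := by
    have := four_mul_two_pow_lt_natAbs hn hd hsmall
    have h1 : 1 ≤ 2 ^ (n - 2 - 1) := Nat.one_le_two_pow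
    omega
  exact ⟨K, inferInstance, inferInstance, hK, h4, hH, hL, not_dvd_classNumber_mersenne hK hn hd hx hsmall hp hp2 hpn hlt⟩

end Summit.BirchSwinnertonDyer.BirchSwinnertonDyer.Theorems.SplitPrimeOrderDoor

end
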